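/-
Copyright (c) 2026. All rights reserved.
Released under Apache 2.0 license as described in the file LICENSE.
Authors: abc-iut cell, Cor. 3.12 sub-crew seat abc-iut-c312-3 (gen 9).
-/
import Literature.IUT.LogVolume.UnitLogValuationSpectrum
import Literature.IUT.LogVolume.UnitLogBoundaryRamificationRoots
import HarnessLib

/-!
# The inner radius at a TIE index `e = A·(p−1)` (`p` odd, `p ∤ A`), I: the level-`A` congruence
# `log_p(1 + ϖ^A·a) ≡ ϖ^A·(a + c·a^p) (mod 𝔪^{A+1})` and the gap at `A − 1`

Proof-only file (theorems, no definitions, no named fact), sequel of `UnitLogValuationSpectrum.lean`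
(`r_in = ⌊e/(p−1)⌋ + 1` for `(p−1) ∤ e`) treating the complementary TIE indices `e = A·(p−1)` with `p ∤ A`
(every multiple of `p − 1` prime to `p`: `e = p−1, 2(p−1), …`; e.g. `p = 7`: `e ∈ {6, 12, …, 30, …, 330, 390, …}`),
by transporting abc-iut-w4/w6's boundary-ramification method (`UnitLogBoundaryRamification*`, the case
`A = 1`) from level `1` to the CRITICAL LEVEL `A = e/(p−1)`.  Setting: `K` a proper ultrametric normed
`ℚ_p`-algebra field, `p` ODD, `ϖ` a norm uniformizer, `c := ϖ^e/p` (a unit).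

* §1 index arithmetic: for `N ∉ {1, p}`, `(p−1)·v_p(N) + 2 ≤ N` (`two_add_mul_padicValNat_le`).
* §2 **THE LEVEL-`A` CONGRUENCE** (`norm_logSeries_sub_le_level`): for `‖a‖ ≤ 1`,
  `‖L(1 + ϖ^A a) − ϖ^A·(a + c·a^p)‖ ≤ ‖ϖ‖^{A+1}` — at level `A` the terms of index `1` and `p` tie
  (`A = A·p − e`) and every other term is `O(ϖ^{A+1})`.
* §3 off the critical level everything is STRICT when `p ∤ A` (`lt_of_le_of_ne_level`): a nonzero
  `log_p u` at a level `s ≠ A` has norm `‖ϖ‖^{β_s}` with `β_s ≤ A − 2` (`s < A`) or `β_s = s ≥ A + 1`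
  (`s > A`), and at level `A` norm `≤ ‖ϖ‖^A`; hence **no unit has `‖log_p u‖ = ‖ϖ‖^{A−1}`**
  (`norm_unitLog_ne_zpow_pred`) and `{‖z‖ ≤ ‖ϖ‖^{A−1}} ⊄ log_p(𝒪_K^×)` (`not_closedBall_pred_subset_logUnits`).
The sequel `UnitLogInnerRadiusTieRoots.lean` adds §4 THE LIFT (unit zeros of the residue polynomial
`ā ↦ ā + c̄·ā^p` ↔ non-trivial `p`-th roots of unity in `K`) and §5 **`ζ_p ∉ K` ⇒ `{‖z‖ ≤ ‖ϖ‖^A} ⊆ log_p(𝒪_K^×)`**,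
i.e. `r_in = A = e/(p−1)` exactly; together with `UnitLogValuationSpectrum` this settles the inner radius at
every index `e` with `p ∤ e` over odd `p`, given the one bit «`ζ_p ∈ K`?».

References: [cite: NeukirchANT1999, Ch. II Prop. (5.5)–(5.7)] [cite: Washington1997, Lemma 1.4, §5.1]
[cite: Koblitz1984, Ch. IV §1–2].  Classical; `logUnits` is the cell's typing of [IUTchIV] Prop. 1.2's
`log_p(R^×)` ([claim: Mochizuki2012, status: disputed] for that locution only).  Consumer (record only):
D-0079 R-W lane U column «rho_in» at tie places (HEX `p = 7`, `e_w ∈ {30, 330, 390}`: `A ∈ {5, 55, 65}`).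
Nothing here is disputed mathematics; no IUT statement is asserted; nothing bears on [IUTchIII] Cor. 3.12.
-/

noncomputable section

open Metric Set
open scoped NormedField

namespace Literature.IUT.LogVolume

namespace LogEnvelope

open RamificationCriterion BoundaryRamification Literature.NumberTheory.GaloisRepresentations.Ultrametric

/-! ### §1. Index arithmetic: `(p−1)·v_p(N) + 2 ≤ N` off `N ∈ {1, p}` -/

section Arith

variable {p : ℕ} [hp : Fact p.Prime]

/-- Bernoulli: `(p−1)·v + 1 ≤ p^v`. [cite: NeukirchANT1999, Ch. II (5.5)] -/
theorem succ_mul_sub_one_le_pow (v : ℕ) : (p - 1) * v + 1 ≤ p ^ v := by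
  have hp1 : 1 ≤ p := hp.out.one_le
  induction v with
  | zero => simp
  | succ v ih =>
    have h1 : 1 ≤ p ^ v := Nat.one_le_pow _ _ hp.out.pos
    calc (p - 1) * (v + 1) + 1 = ((p - 1) * v + 1) + (p - 1) * 1 := by ring
      _ ≤ p ^ v + (p - 1) * p ^ v := Nat.add_le_add ih (Nat.mul_le_mul_left _ h1)
      _ = p ^ (v + 1) := by
        rw [pow_succ]
        zify [hp1]
        ring

/-- Strict Bernoulli from the second power on: `(p−1)·v + 2 ≤ p^v` for `v ≥ 2`.
[cite: NeukirchANT1999, Ch. II (5.5)] -/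
theorem two_add_mul_sub_one_le_pow {v : ℕ} (hv : 2 ≤ v) : (p - 1) * v + 2 ≤ p ^ v := by
  have hp2 : 2 ≤ p := hp.out.two_le
  have hp1 : 1 ≤ p := hp.out.one_le
  induction v, hv using Nat.le_induction with
  | base =>
    have : (p - 1) * 2 + 2 = 2 * p := by zify [hp1]; ring
    rw [this, pow_two]
    exact Nat.mul_le_mul_right _ hp2
  | succ v hv ih =>
    have h1 : 1 ≤ p ^ v := Nat.one_le_pow _ _ hp.out.pos
    calc (p - 1) * (v + 1) + 2 = ((p - 1) * v + 2) + (p - 1) * 1 := by ring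
      _ ≤ p ^ v + (p - 1) * p ^ v := Nat.add_le_add ih (Nat.mul_le_mul_left _ h1)
      _ = p ^ (v + 1) := by
        rw [pow_succ]
        zify [hp1]
        ring

/-- **`(p−1)·v_p(N) + 2 ≤ N` for `N ∉ {0, 1, p}`**: write `N = p^v·m` (`p ∤ m`); if `m ≥ 2` use Bernoulli,
if `m = 1` then `v ≥ 2` and use strict Bernoulli. [cite: NeukirchANT1999, Ch. II (5.5)] -/
theorem two_add_mul_padicValNat_le {N : ℕ} (hN0 : N ≠ 0) (hN1 : N ≠ 1) (hNp : N ≠ p) :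
    (p - 1) * padicValNat p N + 2 ≤ N := by
  obtain ⟨v, m, hm, rfl⟩ := Nat.exists_eq_pow_mul_and_not_dvd hN0 p hp.out.ne_one
  rw [padicValNat_prime_pow_mul hm]
  have hm1 : 1 ≤ m := Nat.one_le_iff_ne_zero.mpr (by rintro rfl; exact hm (dvd_zero p))
  rcases Nat.lt_or_ge m 2 with hm2 | hm2
  · -- `m = 1`, so `N = p^v` with `v ≠ 0, 1`
    have hm1' : m = 1 := by omega
    subst hm1'
    rw [mul_one] at hN1 hNp ⊢
    have hv0 : v ≠ 0 := by rintro rfl; exact hN1 (pow_zero p)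
    have hv1 : v ≠ 1 := by rintro rfl; exact hNp (pow_one p)
    exact two_add_mul_sub_one_le_pow (by omega)
  · -- `m ≥ 2`
    have hB := succ_mul_sub_one_le_pow (p := p) v
    calc (p - 1) * v + 2 ≤ 2 * ((p - 1) * v + 1) := by omega
      _ ≤ m * p ^ v := Nat.mul_le_mul hm2 hB
      _ = p ^ v * m := mul_comm _ _

end Arith

/-! ### §2. The level-`A` congruence -/

section Field

variable (p : ℕ) [hp : Fact p.Prime]
variable {K : Type*} [NontriviallyNormedField K] [instK : NormedAlgebra ℚ_[p] K] [IsUltrametricDist K]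
  [ProperSpace K]
variable {ϖ : Kˣ} (hϖ : IsUniformizer ϖ) {A : ℕ} (hA : absRamificationIdx p K = A * (p - 1))
include hϖ hA

omit hϖ in
/-- `A ≥ 1` (as `e ≥ 1`). [cite: NeukirchANT1999, Ch. II (5.5)] -/
theorem one_le_level : 1 ≤ A := by
  have he := absRamificationIdx_pos p K
  rw [hA] at he
  exact Nat.one_le_iff_ne_zero.mpr fun h => by simp [h] at he

omit hϖ in
/-- `⌊e/(p−1)⌋ = A` at a tie index. [cite: NeukirchANT1999, Ch. II (5.5)] -/
theorem div_eq_level : absRamificationIdx p K / (p - 1) = A := by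
  have hq0 : 0 < p - 1 := by have := hp.out.two_le; omega
  rw [hA, Nat.mul_div_cancel _ hq0]

omit hA in
/-- `c = ϖ^e/p` is a unit. [cite: NeukirchANT1999, Ch. II (5.5)] -/
theorem norm_coeff_level_eq_one : ‖(ϖ : K) ^ absRamificationIdx p K / (p : K)‖ = 1 := by
  rw [norm_div, norm_pow, norm_pow_absRamificationIdx p K hϖ, norm_prime p K,
    div_self (inv_ne_zero (by exact_mod_cast hp.out.ne_zero))]

/-- **Every term of `L(1 + x)` other than those of index `1` and `p` is `O(ϖ^{A+1})`** when `‖x‖ ≤ ‖ϖ‖^A`: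
the term of index `N` has norm `≤ ‖ϖ‖^{A·N − e·v_p(N)}` and `A·N − e·v_p(N) = A·(N − (p−1)·v_p(N)) ≥ 2A ≥ A+1`.
[cite: NeukirchANT1999, Ch. II (5.5)] -/
theorem norm_logTerm_le_level {x : K} (hx : ‖x‖ ≤ ‖(ϖ : K)‖ ^ A) {n : ℕ} (hn0 : n ≠ 0)
    (hnp : n + 1 ≠ p) : ‖-((1 - (1 + x)) ^ (n + 1)) / (n + 1 : K)‖ ≤ ‖(ϖ : K)‖ ^ (A + 1) := by
  have hρ0 : 0 < ‖(ϖ : K)‖ := norm_units_pos ϖ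
  have hA1 := one_le_level p hA
  rw [LogVolume.norm_logTerm_eq p K (1 + x) n, show (1 : K) - (1 + x) = -x by ring, norm_neg,
    natCast_prime_pow_eq_zpow p hϖ, hA]
  have har := two_add_mul_padicValNat_le (p := p) (Nat.succ_ne_zero n) (by omega) hnp
  set v : ℕ := padicValNat p (n + 1) with hv
  -- `‖x‖^{n+1} ≤ ‖ϖ‖^{A(n+1)}`
  have h1 : ‖x‖ ^ (n + 1) ≤ (‖(ϖ : K)‖ ^ A) ^ (n + 1) := pow_le_pow_left₀ (norm_nonneg _) hx _
  -- the exponent inequality `A + 1 ≤ A(n+1) − A(p−1)·v`, from `(p−1)v + 2 ≤ n+1`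
  have hq : p - 1 + 1 = p := Nat.sub_add_cancel hp.out.one_le
  have hexp : ((A + 1 : ℕ) : ℤ) ≤ ((A * (n + 1) : ℕ) : ℤ) - ((A * (p - 1) : ℕ) : ℤ) * (v : ℤ) := by
    have h4 : A * ((p - 1) * v + 2) ≤ A * (n + 1) := Nat.mul_le_mul_left A har
    have h5 : A + 1 ≤ A * 2 := by omega
    have h6 : ((A + 1 + A * ((p - 1) * v) : ℕ) : ℤ) ≤ ((A * (n + 1) : ℕ) : ℤ) := by
      have : A + 1 + A * ((p - 1) * v) ≤ A * (n + 1) := by nlinarith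
      exact_mod_cast this
    have h7 : ((A + 1 + A * ((p - 1) * v) : ℕ) : ℤ) = ((A + 1 : ℕ) : ℤ) + ((A * (p - 1) : ℕ) : ℤ) * (v : ℤ) := by
      push_cast; ring
    linarith [h6, h7]
  calc ‖x‖ ^ (n + 1) * ‖(ϖ : K)‖ ^ (-(((A * (p - 1) : ℕ) : ℤ) * (v : ℤ)))
      ≤ (‖(ϖ : K)‖ ^ A) ^ (n + 1) * ‖(ϖ : K)‖ ^ (-(((A * (p - 1) : ℕ) : ℤ) * (v : ℤ))) :=
        mul_le_mul_of_nonneg_right h1 (zpow_pos hρ0 _).le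
    _ = ‖(ϖ : K)‖ ^ (((A * (n + 1) : ℕ) : ℤ) - ((A * (p - 1) : ℕ) : ℤ) * (v : ℤ)) := by
        rw [← pow_mul, ← zpow_natCast, ← zpow_add₀ hρ0.ne', sub_eq_add_neg]
    _ ≤ ‖(ϖ : K)‖ ^ ((A + 1 : ℕ) : ℤ) := zpow_le_zpow_right_of_le_one₀ hρ0 hϖ.1.le hexp
    _ = ‖(ϖ : K)‖ ^ (A + 1) := zpow_natCast _ _

/-- **THE LEVEL-`A` CONGRUENCE: `‖L(1 + ϖ^A·a) − ϖ^A·(a + c·a^p)‖ ≤ ‖ϖ‖^{A+1}`** for `‖a‖ ≤ 1`, `c = ϖ^e/p`,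
`p` odd: the terms of index `1` and `p` of the series are `ϖ^A a` and `+(ϖ^A a)^p/p = ϖ^A·c·a^p`
(`A + e = A·p`), the rest is `O(ϖ^{A+1})`. [cite: NeukirchANT1999, Ch. II (5.5)] [cite: Washington1997, §5.1] -/
theorem norm_logSeries_sub_le_level (hp2 : p ≠ 2) {a : K} (ha : ‖a‖ ≤ 1) :
    ‖logSeries (1 + (ϖ : K) ^ A * a) -
        (ϖ : K) ^ A * (a + (ϖ : K) ^ absRamificationIdx p K / (p : K) * a ^ p)‖ ≤ ‖(ϖ : K)‖ ^ (A + 1) := by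
  classical
  have hρ0 : 0 < ‖(ϖ : K)‖ := norm_units_pos ϖ
  have hA1 := one_le_level p hA
  have hp3 : 3 ≤ p := by
    have := hp.out.two_le
    omega
  set x : K := (ϖ : K) ^ A * a with hxdef
  have hx : ‖x‖ ≤ ‖(ϖ : K)‖ ^ A := by
    rw [hxdef, norm_mul, norm_pow]
    exact mul_le_of_le_one_right (pow_nonneg (norm_nonneg _) _) ha
  have hyP : IsPrincipal (1 + x) := by
    show ‖1 - (1 + x)‖ < 1
    rw [show (1 : K) - (1 + x) = -x by ring, norm_neg]
    exact hx.trans_lt (pow_lt_one₀ (norm_nonneg _) hϖ.1 (by omega))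
  set f : ℕ → K := fun n => -((1 - (1 + x)) ^ (n + 1)) / (n + 1 : K) with hf
  have hsum : HasSum f (logSeries (1 + x)) := hasSum_logSeries p hyP
  -- remove the terms of index `1` (n = 0) and `p` (n = p − 1)
  have hsum1 : HasSum (fun n => if n = 0 then 0 else f n) (logSeries (1 + x) - f 0) :=
    hasSum_ite_sub_hasSum hsum 0
  have hsum2 : HasSum (fun n => if n = p - 1 then 0 else (if n = 0 then 0 else f n))
      (logSeries (1 + x) - f 0 - (if p - 1 = 0 then 0 else f (p - 1))) :=
    hasSum_ite_sub_hasSum hsum1 (p - 1)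
  rw [if_neg (by omega : p - 1 ≠ 0)] at hsum2
  -- the two removed terms are `x` and `x^p/p = ϖ^A·c·a^p`
  have hodd : Odd p := hp.out.eq_two_or_odd'.resolve_left hp2
  have hf0 : f 0 = x := by
    simp only [hf, zero_add, pow_one, Nat.cast_zero]
    rw [show (1 : K) - (1 + x) = -x by ring, neg_neg, div_one]
  have hden : ((p - 1 : ℕ) : K) + 1 = (p : K) := by
    have h : (p - 1 + 1 : ℕ) = p := Nat.sub_add_cancel hp.out.one_le
    calc ((p - 1 : ℕ) : K) + 1 = ((p - 1 + 1 : ℕ) : K) := by push_cast; ring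
      _ = (p : K) := by rw [h]
  have hAp : A * p = A + absRamificationIdx p K := by
    rw [hA, Nat.mul_sub_one, Nat.add_sub_cancel' (Nat.le_mul_of_pos_right A hp.out.pos)]
  have hfp : f (p - 1) = (ϖ : K) ^ A * ((ϖ : K) ^ absRamificationIdx p K / (p : K) * a ^ p) := by
    have h1 : f (p - 1) = x ^ p / (p : K) := by
      simp only [hf]
      rw [hden, Nat.sub_add_cancel hp.out.one_le, show (1 : K) - (1 + x) = -x by ring, hodd.neg_pow,
        neg_neg]
    rw [h1, hxdef, mul_pow, ← pow_mul, hAp, pow_add]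
    ring
  have hsplit : logSeries (1 + x) - (ϖ : K) ^ A * (a + (ϖ : K) ^ absRamificationIdx p K / (p : K) * a ^ p)
      = logSeries (1 + x) - f 0 - f (p - 1) := by
    rw [hf0, hfp, hxdef]
    ring
  rw [hsplit, ← hsum2.tsum_eq]
  refine IsUltrametricDist.norm_tsum_le_of_forall_le_of_nonneg (pow_nonneg hρ0.le _) fun n => ?_
  by_cases hn1 : n = p - 1
  · rw [if_pos hn1, norm_zero]
    exact pow_nonneg hρ0.le _
  rw [if_neg hn1]
  by_cases hn0 : n = 0
  · rw [if_pos hn0, norm_zero]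
    exact pow_nonneg hρ0.le _
  rw [if_neg hn0]
  exact norm_logTerm_le_level p hϖ hA hx hn0 (by omega)

/-! ### §3. Off the critical level: strictness for `p ∤ A`, and the gap at `A − 1` -/

omit hϖ in
/-- **For `p ∤ A`, every level `s ≠ A` has a STRICT turning point**: `e = s·p^{a₀}·(p−1)` would force
`A = s·p^{a₀}`, i.e. `s = A` (`a₀ = 0`) or `p ∣ A`. [cite: NeukirchANT1999, Ch. II (5.5)] -/
theorem lt_of_le_of_ne_level (hpA : ¬ p ∣ A) {s : ℤ} (hs : 1 ≤ s) (hsA : s ≠ A) {a₀ : ℕ}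
    (hhi : (absRamificationIdx p K : ℤ) ≤ s * (p : ℤ) ^ a₀ * ((p : ℤ) - 1)) :
    (absRamificationIdx p K : ℤ) < s * (p : ℤ) ^ a₀ * ((p : ℤ) - 1) := by
  have hp1 : 1 ≤ p := hp.out.one_le
  have hq0 : (0 : ℤ) < (p : ℤ) - 1 := by
    have : (2 : ℤ) ≤ p := by exact_mod_cast hp.out.two_le
    linarith
  refine lt_of_le_of_ne hhi fun heq => ?_
  rw [hA] at heq
  push_cast [Nat.cast_sub hp1] at heq
  have hAs : (A : ℤ) = s * (p : ℤ) ^ a₀ := mul_right_cancel₀ hq0.ne' heq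
  rcases Nat.eq_zero_or_pos a₀ with h0 | h0
  · subst h0
    rw [pow_zero, mul_one] at hAs
    exact hsA hAs.symm
  · apply hpA
    have hs0 : 0 ≤ s := by omega
    refine ⟨s.toNat * p ^ (a₀ - 1), ?_⟩
    have h : ((A : ℕ) : ℤ) = ((p * (s.toNat * p ^ (a₀ - 1)) : ℕ) : ℤ) := by
      push_cast
      rw [Int.toNat_of_nonneg hs0, hAs, mul_left_comm, ← pow_succ', Nat.sub_add_cancel h0]
    exact_mod_cast h

/-- **No unit has `‖log_p u‖ = ‖ϖ‖^{A−1}`** (`p ∤ A`): at a level `s ≠ A` the norm is `‖ϖ‖^{β_s}` with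
`β_s < s ≤ A − 1` (`s < A`) or `β_s = s ≥ A + 1` (`s > A`); at level `A` it is `≤ ‖ϖ‖^A`.
[cite: NeukirchANT1999, Ch. II (5.5)] -/
theorem norm_unitLog_ne_zpow_pred (hpA : ¬ p ∣ A) (u : K) :
    ‖unitLog u‖ ≠ ‖(ϖ : K)‖ ^ ((A : ℤ) - 1) := by
  have hρ0 : 0 < ‖(ϖ : K)‖ := norm_units_pos ϖ
  have hP : (2 : ℤ) ≤ (p : ℤ) := by exact_mod_cast hp.out.two_le
  have hp1 : 1 ≤ p := hp.out.one_le
  by_cases hu1 : ‖u‖ = 1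
  swap
  · rw [unitLog_of_norm_ne_one hu1, norm_zero]
    exact (ne_of_gt (zpow_pos hρ0 _)).symm
  obtain ⟨m, hm0, hmp, hmP⟩ := exists_pow_isPrincipal_not_dvd (p := p) hu1
  rw [unitLog_eq_inv_mul_logSeries p hm0 hmP, norm_mul, norm_inv, norm_natCast_eq_one_of_not_dvd p hmp,
    inv_one, one_mul]
  by_cases hy1 : u ^ m = 1
  · rw [hy1, logSeries_one, norm_zero]
    exact (ne_of_gt (zpow_pos hρ0 _)).symm
  -- the level `s ≥ 1` of `u^m` and its turning point
  have hx : (1 : K) - u ^ m ≠ 0 := sub_ne_zero.mpr (Ne.symm hy1)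
  obtain ⟨s, hs⟩ := hϖ.2 (Units.mk0 (1 - u ^ m) hx)
  rw [Units.val_mk0] at hs
  have hs1 : 1 ≤ s := by
    have h1 : ‖(ϖ : K)‖ ^ s < 1 := hs ▸ hmP
    have := (zpow_lt_one_iff_right_of_lt_one₀ hρ0 hϖ.1).mp h1
    omega
  obtain ⟨a₀, hlo, hhi⟩ := exists_turning_level (p := p) hs1 (absRamificationIdx p K)
  set e : ℕ := absRamificationIdx p K with he_def
  have heA : (e : ℤ) = (A : ℤ) * ((p : ℤ) - 1) := by
    rw [hA]; push_cast [Nat.cast_sub hp1]; ring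
  intro hEq
  by_cases hsA : s = A
  · -- level `A`: the norm is `≤ ‖ϖ‖^A < ‖ϖ‖^{A−1}`
    have hle := norm_logSeries_le_zpow_level p hϖ hs1 hlo hhi hs
    have hmin := exponent_min (a₀ := a₀) hs1 hP hlo hhi 0
    rw [pow_zero, mul_one, Nat.cast_zero, mul_zero, sub_zero] at hmin
    -- `β ≥ ... ` no: `β ≤ s = A`, so `‖ϖ‖^β ≥ ‖ϖ‖^A`?? we need the other direction: use `β ≥`? No —
    -- at level `A` the turning point is `a₀ = 0` and `β = A`.
    have ha₀ : a₀ = 0 := by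
      by_contra h
      have h0 := hlo 0 (Nat.pos_of_ne_zero h)
      rw [pow_zero, mul_one, hsA] at h0
      exact absurd h0 (not_lt.mpr (le_of_eq heA))
    subst ha₀
    rw [pow_zero, mul_one, Nat.cast_zero, mul_zero, sub_zero, hsA] at hle
    rw [hEq] at hle
    have := (zpow_le_zpow_iff_right_of_lt_one₀ hρ0 hϖ.1).mp hle
    omega
  · -- level `s ≠ A`: strict, norm `= ‖ϖ‖^{β_s}` with `β_s ≠ A − 1`
    have hhi' := lt_of_le_of_ne_level p hA hpA hs1 (fun h => hsA (by exact_mod_cast h)) hhi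
    have hnorm := norm_logSeries_eq_zpow_level p hϖ hs1 hlo hhi' hs
    rw [hnorm] at hEq
    have hβ := zpow_right_injective₀ hρ0 hϖ.1.ne hEq
    rcases lt_or_gt_of_ne hsA with hlt | hgt
    · -- `s < A`: `a₀ ≥ 1` and `β ≤ s·p − e < s ≤ A − 1`
      have hsl : s * ((p : ℤ) - 1) < e := by
        rw [heA]; exact mul_lt_mul_of_pos_right hlt (by linarith)
      have ha₀ : a₀ ≠ 0 := by
        rintro rfl
        rw [pow_zero, mul_one] at hhi'
        exact absurd hhi' (not_lt.mpr hsl.le)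
      have hmin := exponent_min (a₀ := a₀) hs1 hP hlo hhi'.le 1
      rw [pow_one, Nat.cast_one, mul_one] at hmin
      nlinarith
    · -- `s > A`: `a₀ = 0` and `β = s ≥ A + 1`
      have ha₀ : a₀ = 0 := by
        by_contra h
        have h0 := hlo 0 (Nat.pos_of_ne_zero h)
        rw [pow_zero, mul_one] at h0
        have : (A : ℤ) * ((p : ℤ) - 1) < s * ((p : ℤ) - 1) := mul_lt_mul_of_pos_right hgt (by linarith)
        linarith
      subst ha₀
      rw [pow_zero, mul_one, Nat.cast_zero, mul_zero, sub_zero] at hβ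
      omega

/-- **`{‖z‖ ≤ ‖ϖ‖^{A−1}} ⊄ log_p(𝒪_K^×)`** at a tie index with `p ∤ A`: `ϖ^{A−1}` is not a logarithm.
[cite: NeukirchANT1999, Ch. II (5.5)] -/
theorem not_closedBall_pred_subset_logUnits (hpA : ¬ p ∣ A) :
    ¬ closedBall (0 : K) (‖(ϖ : K)‖ ^ (A - 1)) ⊆ logUnits K := by
  intro h
  have hA1 := one_le_level p hA
  have hmem : (ϖ : K) ^ (A - 1) ∈ closedBall (0 : K) (‖(ϖ : K)‖ ^ (A - 1)) := by
    rw [mem_closedBall_zero_iff, norm_pow]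
  obtain ⟨u, -, hu⟩ := h hmem
  refine norm_unitLog_ne_zpow_pred p hϖ hA hpA u ?_
  rw [hu, norm_pow, ← zpow_natCast, Nat.cast_sub hA1, Nat.cast_one]

end Field

end LogEnvelope

end Literature.IUT.LogVolume

end
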